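import Summits.SmoothPoincare4.SmoothPoincare4.Theses.EntropyRung
import Summits.SmoothPoincare4.SmoothPoincare4.Theorems.EntropyRungSubcylindricalExistenceHardyBlowup
import HarnessLib

/-!
# Cut-off cost absorption by the local Yamabe–Sobolev inequality — pointwise inequalities
(helper `helper_cutoffAbsorptionI` for line `fat-conical-core-avr-logsobolev`, crux
`EntropyRung.SubcylindricalExistence`, item stmt-SmoothPoincare4-10871)

Pointwise tools for the "local absorption" of the cut-off cost of a partition `Σⱼ χⱼ² = 1`
(`j ≤ n`) by the two-piece windows `ηᵢ = χᵢ² + χᵢ₊₁²` (`i < n`): the parallelogram bound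
`g⁻¹(aα + bβ, aα + bβ) ≤ 2a² g⁻¹(α, α) + 2b² g⁻¹(β, β)` for the (positive semidefinite) inverse
of a Riemannian metric, whence `|∇(ηu)|² ≤ 2η²|∇u|² + 2u²|∇η|²` and
`|∇(χa² + χb²)|² ≤ 8(χa²|∇χa|² + χb²|∇χb|²)`; the window facts `0 ≤ ηᵢ ≤ 1`, `Σᵢ ηᵢ ≤ 2`,
`Σᵢ |∇ηᵢ|² ≤ 16 Σⱼ |∇χⱼ|²`; and the summed bound on the Sobolev densities of the `ηᵢ u`,
`Σᵢ [6Φ²|∇(ηᵢu)|² + rΦ⁴(ηᵢu)²] ≤ 6(4Φ²|∇u|² + rΦ⁴u²) + 192 u²Φ² Σⱼ|∇χⱼ|²`.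
Everything is proved; no definitions, no named facts.
-/

noncomputable section

-- the registered namespace `Summit.SmoothPoincare4.SmoothPoincare4.Theorems` repeats a component
set_option linter.dupNamespace false

open scoped Manifold ContDiff Topology ENNReal NNReal
open Set Filter MeasureTheory
open Literature.Geometry.Lorentzian Literature.Geometry.Riemannian

namespace Summit.SmoothPoincare4.SmoothPoincare4.Theorems

namespace CutoffAbsorption

variable {M : Type} [TopologicalSpace M]
  [ChartedSpace (EuclideanSpace ℝ (Fin 4)) M] [IsManifold (𝓡 4) ∞ M]
  (g : PseudoRiemannianMetric (𝓡 4) ∞ (EuclideanSpace ℝ (Fin 4)) (TangentSpace (𝓡 4) : M → Type _))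

/-! ### Inverse-metric inequalities -/

/-- Parallelogram bound for the positive semidefinite inverse metric of a Riemannian metric:
`g⁻¹(aα + bβ, aα + bβ) ≤ 2a² g⁻¹(α, α) + 2b² g⁻¹(β, β)` (from `0 ≤ g⁻¹(aα − bβ, aα − bβ)`). -/
theorem innerDual_smul_add_smul_self_le (hg : g.IsRiemannian) (x : M)
    (α β : Module.Dual ℝ (TangentSpace (𝓡 4) x)) (a b : ℝ) :
    g.innerDual x (a • α + b • β) (a • α + b • β) ≤
      2 * (a ^ 2 * g.innerDual x α α) + 2 * (b ^ 2 * g.innerDual x β β) := by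
  have h0 := g.innerDual_self_nonneg hg x (a • α + (-b) • β)
  rw [HardyBlowup.innerDual_smul_add_smul_self] at h0
  rw [HardyBlowup.innerDual_smul_add_smul_self]
  nlinarith [h0]

omit [IsManifold (𝓡 4) ∞ M] in
/-- A smooth real function is differentiable at every point. -/
theorem mdiff {f : M → ℝ} (hf : ContMDiff (𝓡 4) 𝓘(ℝ, ℝ) ∞ f) (x : M) :
    MDifferentiableAt (𝓡 4) 𝓘(ℝ, ℝ) f x :=
  (hf x).mdifferentiableAt (by simp)

/-- `|∇(η u)|²_g ≤ 2 η² |∇u|²_g + 2 u² |∇η|²_g`. -/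
theorem gradSq_mul_le (hg : g.IsRiemannian) {η u : M → ℝ} {x : M}
    (hη : MDifferentiableAt (𝓡 4) 𝓘(ℝ, ℝ) η x) (hu : MDifferentiableAt (𝓡 4) 𝓘(ℝ, ℝ) u x) :
    g.gradSq (fun y ↦ η y * u y) x ≤
      2 * (η x ^ 2 * g.gradSq u x) + 2 * (u x ^ 2 * g.gradSq η x) := by
  simp only [PseudoRiemannianMetric.gradSq]
  rw [EntropyLocalisation.dcov_mul hη hu]
  exact innerDual_smul_add_smul_self_le g hg x _ _ (η x) (u x)

/-- `|∇(χa² + χb²)|²_g ≤ 8 (χa² |∇χa|²_g + χb² |∇χb|²_g)`. -/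
theorem gradSq_sq_add_sq_le (hg : g.IsRiemannian) {χa χb : M → ℝ}
    (ha : ContMDiff (𝓡 4) 𝓘(ℝ, ℝ) ∞ χa) (hb : ContMDiff (𝓡 4) 𝓘(ℝ, ℝ) ∞ χb) (x : M) :
    g.gradSq (fun y ↦ χa y ^ 2 + χb y ^ 2) x ≤
      8 * (χa x ^ 2 * g.gradSq χa x) + 8 * (χb x ^ 2 * g.gradSq χb x) := by
  have hda : MDifferentiableAt (𝓡 4) 𝓘(ℝ, ℝ) (fun y ↦ χa y ^ 2) x := mdiff (ha.pow 2) x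
  have hdb : MDifferentiableAt (𝓡 4) 𝓘(ℝ, ℝ) (fun y ↦ χb y ^ 2) x := mdiff (hb.pow 2) x
  have hd : (mvfderiv (𝓡 4) (fun y ↦ χa y ^ 2 + χb y ^ 2) x).toLinearMap =
      (2 * χa x) • (mvfderiv (𝓡 4) χa x).toLinearMap +
        (2 * χb x) • (mvfderiv (𝓡 4) χb x).toLinearMap := by
    rw [mvfderiv_fun_add hda hdb, ContinuousLinearMap.toLinearMap_add,
      HardyBlowup.dcov_sq (mdiff ha x), HardyBlowup.dcov_sq (mdiff hb x)]
  have h : g.innerDual x (mvfderiv (𝓡 4) (fun y ↦ χa y ^ 2 + χb y ^ 2) x).toLinearMap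
      (mvfderiv (𝓡 4) (fun y ↦ χa y ^ 2 + χb y ^ 2) x).toLinearMap ≤
      2 * ((2 * χa x) ^ 2 *
        g.innerDual x (mvfderiv (𝓡 4) χa x).toLinearMap (mvfderiv (𝓡 4) χa x).toLinearMap)
      + 2 * ((2 * χb x) ^ 2 *
        g.innerDual x (mvfderiv (𝓡 4) χb x).toLinearMap (mvfderiv (𝓡 4) χb x).toLinearMap) := by
    rw [hd]
    exact innerDual_smul_add_smul_self_le g hg x _ _ _ _
  simp only [PseudoRiemannianMetric.gradSq]
  nlinarith [h]

/-! ### The two-piece windows `ηᵢ = χᵢ² + χᵢ₊₁²` of a partition `Σⱼ χⱼ² = 1` -/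

section Windows

variable {n : ℕ} {χ : Fin (n + 1) → M → ℝ}

omit [TopologicalSpace M] [ChartedSpace (EuclideanSpace ℝ (Fin 4)) M] [IsManifold (𝓡 4) ∞ M] in
/-- Each piece satisfies `χⱼ² ≤ 1`. -/
theorem sq_le_one (h1 : ∀ x, ∑ j, χ j x ^ 2 = 1) (j : Fin (n + 1)) (x : M) : χ j x ^ 2 ≤ 1 := by
  calc χ j x ^ 2 ≤ ∑ k, χ k x ^ 2 :=
        Finset.single_le_sum (f := fun k ↦ χ k x ^ 2) (fun k _ ↦ sq_nonneg (χ k x)) (Finset.mem_univ j)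
    _ = 1 := h1 x

omit [TopologicalSpace M] [ChartedSpace (EuclideanSpace ℝ (Fin 4)) M] [IsManifold (𝓡 4) ∞ M] in
/-- The windows satisfy `0 ≤ ηᵢ ≤ 1`. -/
theorem window_le_one (h1 : ∀ x, ∑ j, χ j x ^ 2 = 1) (i : Fin n) (x : M) :
    χ (Fin.castSucc i) x ^ 2 + χ i.succ x ^ 2 ≤ 1 := by
  have hne : Fin.castSucc i ≠ i.succ := Fin.castSucc_lt_succ.ne
  calc χ (Fin.castSucc i) x ^ 2 + χ i.succ x ^ 2
      = ∑ j ∈ ({Fin.castSucc i, i.succ} : Finset (Fin (n + 1))), χ j x ^ 2 :=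
        (Finset.sum_pair (f := fun j ↦ χ j x ^ 2) hne).symm
    _ ≤ ∑ j, χ j x ^ 2 :=
        Finset.sum_le_sum_of_subset_of_nonneg (Finset.subset_univ _) fun j _ _ ↦ sq_nonneg (χ j x)
    _ = 1 := h1 x

omit [TopologicalSpace M] [ChartedSpace (EuclideanSpace ℝ (Fin 4)) M] [IsManifold (𝓡 4) ∞ M] in
/-- On a zone meeting only the pieces `i, i + 1` the window `ηᵢ` equals `1`. -/
theorem window_eq_one (h1 : ∀ x, ∑ j, χ j x ^ 2 = 1) (i : Fin n) {x : M}
    (hx : ∀ j : Fin (n + 1), χ j x ≠ 0 → ((j : ℕ) = (i : ℕ) ∨ (j : ℕ) = (i : ℕ) + 1)) :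
    χ (Fin.castSucc i) x ^ 2 + χ i.succ x ^ 2 = 1 := by
  have hne : Fin.castSucc i ≠ i.succ := Fin.castSucc_lt_succ.ne
  rw [← h1 x, Finset.sum_eq_add_of_mem (Fin.castSucc i) i.succ (Finset.mem_univ _)
    (Finset.mem_univ _) hne]
  intro c _ hc
  have h0 : χ c x = 0 := by
    by_contra hcx
    rcases hx c hcx with h | h
    · exact hc.1 (Fin.ext (by simp [h]))
    · exact hc.2 (Fin.ext (by simp [h]))
  simp [h0]

omit [TopologicalSpace M] [ChartedSpace (EuclideanSpace ℝ (Fin 4)) M] [IsManifold (𝓡 4) ∞ M] in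
/-- `Σᵢ ηᵢ ≤ 2`. -/
theorem sum_window_le_two (h1 : ∀ x, ∑ j, χ j x ^ 2 = 1) (x : M) :
    ∑ i : Fin n, (χ (Fin.castSucc i) x ^ 2 + χ i.succ x ^ 2) ≤ 2 := by
  rw [Finset.sum_add_distrib]
  have hA := Fin.sum_univ_castSucc (fun j ↦ χ j x ^ 2)
  have hB := Fin.sum_univ_succ (fun j ↦ χ j x ^ 2)
  nlinarith [h1 x, sq_nonneg (χ (Fin.last n) x), sq_nonneg (χ 0 x)]

/-- `Σᵢ |∇ηᵢ|² ≤ 16 Σⱼ |∇χⱼ|²`. -/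
theorem sum_gradSq_window_le (hg : g.IsRiemannian) (h1 : ∀ x, ∑ j, χ j x ^ 2 = 1)
    (hχ : ∀ j, ContMDiff (𝓡 4) 𝓘(ℝ, ℝ) ∞ (χ j)) (x : M) :
    ∑ i : Fin n, g.gradSq (fun y ↦ χ (Fin.castSucc i) y ^ 2 + χ i.succ y ^ 2) x ≤
      16 * ∑ j, g.gradSq (χ j) x := by
  have hterm : ∀ i : Fin n, g.gradSq (fun y ↦ χ (Fin.castSucc i) y ^ 2 + χ i.succ y ^ 2) x ≤
      8 * (g.gradSq (χ (Fin.castSucc i)) x + g.gradSq (χ i.succ) x) := by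
    intro i
    have h := gradSq_sq_add_sq_le g hg (hχ (Fin.castSucc i)) (hχ i.succ) x
    have ha : χ (Fin.castSucc i) x ^ 2 * g.gradSq (χ (Fin.castSucc i)) x ≤
        g.gradSq (χ (Fin.castSucc i)) x :=
      mul_le_of_le_one_left (g.gradSq_nonneg hg _ x) (sq_le_one h1 _ x)
    have hb : χ i.succ x ^ 2 * g.gradSq (χ i.succ) x ≤ g.gradSq (χ i.succ) x :=
      mul_le_of_le_one_left (g.gradSq_nonneg hg _ x) (sq_le_one h1 _ x)
    linarith
  have hA := Fin.sum_univ_castSucc (fun j ↦ g.gradSq (χ j) x)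
  have hB := Fin.sum_univ_succ (fun j ↦ g.gradSq (χ j) x)
  have hl := g.gradSq_nonneg hg (χ (Fin.last n)) x
  have h0 := g.gradSq_nonneg hg (χ 0) x
  calc ∑ i : Fin n, g.gradSq (fun y ↦ χ (Fin.castSucc i) y ^ 2 + χ i.succ y ^ 2) x
      ≤ ∑ i : Fin n, 8 * (g.gradSq (χ (Fin.castSucc i)) x + g.gradSq (χ i.succ) x) :=
        Finset.sum_le_sum fun i _ ↦ hterm i
    _ = 8 * ((∑ i : Fin n, g.gradSq (χ (Fin.castSucc i)) x) + ∑ i : Fin n, g.gradSq (χ i.succ) x) := by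
        rw [← Finset.mul_sum, Finset.sum_add_distrib]
    _ ≤ 16 * ∑ j, g.gradSq (χ j) x := by nlinarith

/-- **Summed bound on the Sobolev densities of the windowed functions `ηᵢ u`**:
`Σᵢ [6Φ²|∇(ηᵢu)|² + rΦ⁴(ηᵢu)²] ≤ 6(4Φ²|∇u|² + rΦ⁴u²) + 192 u²Φ² Σⱼ|∇χⱼ|²` (`r ≥ 0`). -/
theorem sum_sobolevDensity_window_le (hg : g.IsRiemannian) (h1 : ∀ x, ∑ j, χ j x ^ 2 = 1)
    (hχ : ∀ j, ContMDiff (𝓡 4) 𝓘(ℝ, ℝ) ∞ (χ j)) {u : M → ℝ} (hu : ContMDiff (𝓡 4) 𝓘(ℝ, ℝ) ∞ u)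
    (Φ : M → ℝ) {r : M → ℝ} (hr : ∀ x, 0 ≤ r x) (x : M) :
    ∑ i : Fin n, (6 * (Φ x ^ 2 *
          g.gradSq (fun y ↦ (χ (Fin.castSucc i) y ^ 2 + χ i.succ y ^ 2) * u y) x)
        + r x * Φ x ^ 4 * ((χ (Fin.castSucc i) x ^ 2 + χ i.succ x ^ 2) * u x) ^ 2)
      ≤ 6 * (4 * (Φ x ^ 2 * g.gradSq u x) + r x * Φ x ^ 4 * u x ^ 2)
        + 192 * (u x ^ 2 * Φ x ^ 2 * ∑ j, g.gradSq (χ j) x) := by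
  have hΦ2 : 0 ≤ Φ x ^ 2 := sq_nonneg _
  have hΦ4 : 0 ≤ Φ x ^ 4 := by positivity
  have hu2 : 0 ≤ u x ^ 2 := sq_nonneg _
  have hGu : 0 ≤ g.gradSq u x := g.gradSq_nonneg hg u x
  have hrx := hr x
  -- per-window bound
  have hterm : ∀ i : Fin n,
      6 * (Φ x ^ 2 * g.gradSq (fun y ↦ (χ (Fin.castSucc i) y ^ 2 + χ i.succ y ^ 2) * u y) x)
        + r x * Φ x ^ 4 * ((χ (Fin.castSucc i) x ^ 2 + χ i.succ x ^ 2) * u x) ^ 2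
      ≤ (χ (Fin.castSucc i) x ^ 2 + χ i.succ x ^ 2) * (12 * (Φ x ^ 2 * g.gradSq u x) + r x * Φ x ^ 4 * u x ^ 2)
        + 12 * (Φ x ^ 2 * u x ^ 2) *
          (8 * (g.gradSq (χ (Fin.castSucc i)) x + g.gradSq (χ i.succ) x)) := by
    intro i
    have hηs : ContMDiff (𝓡 4) 𝓘(ℝ, ℝ) ∞ (fun y ↦ χ (Fin.castSucc i) y ^ 2 + χ i.succ y ^ 2) :=
      ((hχ (Fin.castSucc i)).pow 2).add ((hχ i.succ).pow 2)
    have hG := gradSq_mul_le g hg (mdiff hηs x) (mdiff hu x)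
    have hE := gradSq_sq_add_sq_le g hg (hχ (Fin.castSucc i)) (hχ i.succ) x
    have ha : χ (Fin.castSucc i) x ^ 2 * g.gradSq (χ (Fin.castSucc i)) x ≤
        g.gradSq (χ (Fin.castSucc i)) x :=
      mul_le_of_le_one_left (g.gradSq_nonneg hg _ x) (sq_le_one h1 _ x)
    have hb : χ i.succ x ^ 2 * g.gradSq (χ i.succ) x ≤ g.gradSq (χ i.succ) x :=
      mul_le_of_le_one_left (g.gradSq_nonneg hg _ x) (sq_le_one h1 _ x)
    set e : ℝ := χ (Fin.castSucc i) x ^ 2 + χ i.succ x ^ 2 with he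
    have he0 : 0 ≤ e := by positivity
    have he1 : e ≤ 1 := window_le_one h1 i x
    have he2 : e ^ 2 ≤ e := by nlinarith
    have hGη : 0 ≤ g.gradSq (fun y ↦ χ (Fin.castSucc i) y ^ 2 + χ i.succ y ^ 2) x :=
      g.gradSq_nonneg hg _ x
    have F1 := mul_le_mul_of_nonneg_left hG (show (0 : ℝ) ≤ 6 * Φ x ^ 2 by positivity)
    have F2 := mul_le_mul_of_nonneg_left he2
      (show (0 : ℝ) ≤ 12 * (Φ x ^ 2 * g.gradSq u x) + r x * Φ x ^ 4 * u x ^ 2 by positivity)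
    have F3 := mul_le_mul_of_nonneg_left (le_trans hE (by linarith : _ ≤ 8 * (g.gradSq (χ (Fin.castSucc i)) x + g.gradSq (χ i.succ) x)))
      (show (0 : ℝ) ≤ 12 * (Φ x ^ 2 * u x ^ 2) by positivity)
    nlinarith [F1, F2, F3]
  have hS := sum_window_le_two (χ := χ) h1 x
  have hW := sum_gradSq_window_le g hg h1 hχ x
  have hA0 : 0 ≤ 12 * (Φ x ^ 2 * g.gradSq u x) + r x * Φ x ^ 4 * u x ^ 2 := by positivity
  have hB0 : 0 ≤ 12 * (Φ x ^ 2 * u x ^ 2) := by positivity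
  calc ∑ i : Fin n, (6 * (Φ x ^ 2 *
          g.gradSq (fun y ↦ (χ (Fin.castSucc i) y ^ 2 + χ i.succ y ^ 2) * u y) x)
        + r x * Φ x ^ 4 * ((χ (Fin.castSucc i) x ^ 2 + χ i.succ x ^ 2) * u x) ^ 2)
      ≤ ∑ i : Fin n, ((χ (Fin.castSucc i) x ^ 2 + χ i.succ x ^ 2) *
            (12 * (Φ x ^ 2 * g.gradSq u x) + r x * Φ x ^ 4 * u x ^ 2)
          + 12 * (Φ x ^ 2 * u x ^ 2) *
            (8 * (g.gradSq (χ (Fin.castSucc i)) x + g.gradSq (χ i.succ) x))) :=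
        Finset.sum_le_sum fun i _ ↦ hterm i
    _ = (∑ i : Fin n, (χ (Fin.castSucc i) x ^ 2 + χ i.succ x ^ 2)) *
            (12 * (Φ x ^ 2 * g.gradSq u x) + r x * Φ x ^ 4 * u x ^ 2)
          + 12 * (Φ x ^ 2 * u x ^ 2) *
            (8 * ((∑ i : Fin n, g.gradSq (χ (Fin.castSucc i)) x) + ∑ i : Fin n, g.gradSq (χ i.succ) x)) := by
        rw [Finset.sum_add_distrib, ← Finset.sum_mul, ← Finset.sum_add_distrib, Finset.mul_sum,
          Finset.mul_sum]
    _ ≤ 2 * (12 * (Φ x ^ 2 * g.gradSq u x) + r x * Φ x ^ 4 * u x ^ 2)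
          + 12 * (Φ x ^ 2 * u x ^ 2) * (8 * (2 * ∑ j, g.gradSq (χ j) x)) := by
        have hA := Fin.sum_univ_castSucc (fun j ↦ g.gradSq (χ j) x)
        have hB := Fin.sum_univ_succ (fun j ↦ g.gradSq (χ j) x)
        have hl := g.gradSq_nonneg hg (χ (Fin.last n)) x
        have h0 := g.gradSq_nonneg hg (χ 0) x
        have hsum : (∑ i : Fin n, g.gradSq (χ (Fin.castSucc i)) x) + ∑ i : Fin n, g.gradSq (χ i.succ) x
            ≤ 2 * ∑ j, g.gradSq (χ j) x := by
          linarith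
        nlinarith [mul_le_mul_of_nonneg_right hS hA0, mul_le_mul_of_nonneg_left hsum hB0]
    _ ≤ 6 * (4 * (Φ x ^ 2 * g.gradSq u x) + r x * Φ x ^ 4 * u x ^ 2)
          + 192 * (u x ^ 2 * Φ x ^ 2 * ∑ j, g.gradSq (χ j) x) := by
        nlinarith [mul_nonneg (mul_nonneg hrx hΦ4) hu2]

end Windows

end CutoffAbsorption

/-- **Aux helper (stub `helper_cutoffAbsorptionI_windows`) — summed Sobolev-density bound of the
two-piece windows.** For a smooth partition `Σⱼ χⱼ² = 1` (`j ≤ n`) on a Riemannian 4-manifold,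
the windows `ηᵢ = χᵢ² + χᵢ₊₁²` (`i < n`) satisfy, for smooth `u`, any `Φ` and `r ≥ 0`, pointwise
`Σᵢ [6Φ²|∇(ηᵢu)|² + rΦ⁴(ηᵢu)²] ≤ 6(4Φ²|∇u|² + rΦ⁴u²) + 192 u²Φ² Σⱼ|∇χⱼ|²`
(`|∇(ηu)|² ≤ 2η²|∇u|² + 2u²|∇η|²`, `Σᵢ ηᵢ² ≤ 2`, `Σᵢ |∇ηᵢ|² ≤ 16 Σⱼ|∇χⱼ|²`). Aux for
`helper_cutoffAbsorptionI`, line `fat-conical-core-avr-logsobolev` (crux stmt-SmoothPoincare4-10871). -/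
theorem helper_cutoffAbsorptionI_windows :
    ∀ (M : Type) [TopologicalSpace M] [ChartedSpace (EuclideanSpace ℝ (Fin 4)) M] [IsManifold (𝓡 4) ∞ M]
      (g : PseudoRiemannianMetric (𝓡 4) ∞ (EuclideanSpace ℝ (Fin 4)) (TangentSpace (𝓡 4) : M → Type _)),
      g.IsRiemannian → ∀ (n : ℕ) (χ : Fin (n + 1) → M → ℝ) (u Φ r : M → ℝ),
      (∀ x, ∑ j, χ j x ^ 2 = 1) → (∀ j, ContMDiff (𝓡 4) 𝓘(ℝ, ℝ) ∞ (χ j)) →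
      ContMDiff (𝓡 4) 𝓘(ℝ, ℝ) ∞ u → (∀ x, 0 ≤ r x) →
      ∀ x : M, ∑ i : Fin n, (6 * (Φ x ^ 2 *
            g.gradSq (fun y ↦ (χ (Fin.castSucc i) y ^ 2 + χ i.succ y ^ 2) * u y) x)
          + r x * Φ x ^ 4 * ((χ (Fin.castSucc i) x ^ 2 + χ i.succ x ^ 2) * u x) ^ 2)
        ≤ 6 * (4 * (Φ x ^ 2 * g.gradSq u x) + r x * Φ x ^ 4 * u x ^ 2)
          + 192 * (u x ^ 2 * Φ x ^ 2 * ∑ j, g.gradSq (χ j) x) := by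
  intro M _ _ _ g hg n χ u Φ r h1 hχ hu hr x
  exact CutoffAbsorption.sum_sobolevDensity_window_le g hg h1 hχ hu Φ hr x

end Summit.SmoothPoincare4.SmoothPoincare4.Theorems

end
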